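import Summits.HodgeConjecture.CorCM.MumfordTateRankCMCurvesProductTheta
import Summits.HodgeConjecture.CorCM.MumfordTateRankCMSurfaceTimesTypeIV
import Summits.HodgeConjecture.CorCM.MumfordTateRankTypeIVThreefoldTimesCurves
import HarnessLib

/-!
# The TOWER theorem: `t(A × E₀ × ⋯ × E_m) = t(A) + m + 1` for `A` with imaginary-quadratic `End⁰A = ℚ(√−d)` and CM elliptic curves of pairwise
# distinct fields, none equal to `ℚ(√−d)` unless `A` is balanced (Moonen–Zarhin 1999 Lemma (3.6) / Prop. (3.8) for `m + 1` curves at once)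

COR-CM (cell `pub-hodgecm2`, seat `b27` gen 51, count-neutral Mumford–Tate-rank ladder; theorems only, no definition, no named fact;
UNCONDITIONAL — nothing here uses or asserts HC_CM).  Notation `t(X) = dim MT(H¹X) = dim Lie Hg(H¹X) + 1`.

Gen 48 proved the case of ONE curve (`CorCM/MumfordTateRankTimesCMCurve`: `t(A × E) = t(A) + 1` unless `A` is unbalanced and `End⁰E ≅ End⁰A`), gen 50
the case of TWO (`CorCM/MumfordTateRankTypeIVTimesTwoCMCurves`, three square roots).  Here the number of curves is arbitrary: Moonen–Zarhin's Lemma (3.6)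
for the Lie algebra `hodgeLie` with an ABELIAN summand (`Motives/HodgeLieTimesCMSummand` §6) is applied to the bicone `H¹(A × Y) = fst^* H¹A ⊕ snd^* H¹Y`,
`Y = ⨁_j E_j`; its input — the twisted rigidity of `Lie Hg(H¹Y)` for the slope `tr(Θ_A φ)/tr(φ²) ∈ i√d·ℚ` — is `CorCM/MumfordTateRankCMCurvesProductTheta`
(trace functionals + Besicovitch's independence of `√d_0, …, √d_m, √d`, `CorCM/MumfordTateRankSquareRootsIndependent`).

* §1 **`finrank_hodgeLie_hodge_one_prod_biproduct_cmCurves_eq_add`** — `dim Lie Hg(H¹(A × ⨁E)) = dim Lie Hg(H¹A) + (m + 1)` for `A` with `0 < dim A`,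
  `dim_ℚ End⁰A = 2`, `φ ∘ φ = −d`, curves `χ_j ∘ χ_j = −d_j` with `d_i ≠ s² d_j` (`i ≠ j`), and (`A` balanced, `n₊ = n₋`, OR `d ≠ s² d_j` for all `j`).
* §2 **`mtRank_hodge_one_eq_add_of_isIsogenous_prod_biproduct_cmCurves`** — the field form: `t(X) = t(A) + m + 1` for `X ∼ A × ⨁E`, the `E_j` pairwise
  non-isogenous CM elliptic curves, and (`A` balanced OR no ring homomorphism `End⁰E_j → End⁰A` for every `j`).
* §3 cells: **simple type-IV(2,1) threefold × (m+1) CM curves of distinct fields not mapping to `End⁰T`: `t = m + 11`**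
  (`mtRank_hodge_one_eq_of_isIsogenous_typeIV_threefold_prod_biproduct_cmCurves`); **Ribet type `(g−1,1)` × (m+1) such curves: `t = g² + m + 2`**.

## References
* [MoonenZarhin1999LowDim] B. Moonen, Yu. G. Zarhin, *Hodge classes on abelian varieties of low dimension*, Math. Ann. 315 (1999), §3 (3.1), Lemma (3.6),
  Prop. (3.8), Thm. 0.1 (4) [corpus: paper:arxiv-math_9901113 pp. 1, 6–7]. [cite: MoonenZarhin1999LowDim, §3 Lemma (3.6) and Prop. (3.8)]
* [Besicovitch1940] A. S. Besicovitch, *On the linear independence of fractional powers of integers*, J. London Math. Soc. 15 (1940) 3–6. [cite: Besicovitch1940, Thm. 1]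
* [Deligne1982HodgeCycles] P. Deligne, *Hodge cycles on abelian varieties*, LNM 900 (1982), I §3 Prop. 3.4 and Prop. 3.6. [cite: Deligne1982HodgeCycles, I §3 Prop. 3.6]
* [Ribet1983] K. A. Ribet, *Hodge classes on certain types of abelian varieties*, Amer. J. Math. 105 (1983), Thm. 3. [cite: Ribet1983, Thm. 3]
-/

noncomputable section

open scoped TensorProduct BigOperators
open CategoryTheory CategoryTheory.Limits Module

namespace Summit.HodgeConjecture.CorCM

open Literature.AlgebraicGeometry.Motives
open Literature.AlgebraicGeometry.Motives.AbelianVariety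
open Literature.AlgebraicGeometry.Motives.HodgeStructure
open Literature.AlgebraicGeometry.HodgeTheory
open Literature.AlgebraicGeometry.ComplexMultiplication
open Literature.AlgebraicGeometry.Milne1999 (IsOfCMType)

variable [HodgeTensorFacts.{0, 0}] {X A : AbelianVariety ℂ} {n n₁ k l : ℕ} {m : ℕ} {E : Fin (m + 1) → AbelianVariety ℂ}

/-! ## §1 The product theorem for `A × ⨁E` -/

/-- **`dim Lie Hg(H¹(A × ⨁_j E_j)) = dim Lie Hg(H¹A) + (m + 1)`** for `A` with `0 < dim A`, `dim_ℚ End⁰A = 2`, `φ ∘ φ = −d` (`d > 0`), elliptic curves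
`E₀, …, E_m` with `χ_j ∘ χ_j = −d_j` and `d_i ≠ s²d_j` for `i ≠ j`, provided `A` is balanced (`n₊ = n₋` for `φ` on `H^{1,0}`) OR `d ≠ s²d_j` for all `j`.
Moonen–Zarhin's Lemma (3.6) for `hodgeLie` (`corners_mem_and_exists_linearEquiv_prod_of_abelian_of_rigid`) on the bicone `H¹(A × Y) = fst^* H¹A ⊕ snd^* H¹Y`,
`Y = ⨁E`: skew centre `ℚφ^*` on `H¹A` (`quadraticEnd_skewCentre_data`), `Lie Hg(H¹Y)` abelian of dimension `m + 1` and twisted-rigid for the slope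
`tr(Θ_A φ^*)/tr((φ^*)²)`, `tr(Θ_A φ^*) = 2i√d(n₊ − n₋)` (`CorCM/MumfordTateRankCMCurvesProductTheta`). [cite: MoonenZarhin1999LowDim, §3 Lemma (3.6) and Prop. (3.8)]
[cite: Deligne1982HodgeCycles, I §3 Prop. 3.6] -/
theorem finrank_hodgeLie_hodge_one_prod_biproduct_cmCurves_eq_add (hA : IsSmoothProjective n₁ A.X) (hY : IsSmoothProjective k (⨁ E).X)
    (hP : IsSmoothProjective l (A.prod (⨁ E)).X) (hA0 : 0 < A.dim) (hA2 : Module.finrank ℚ A.endAlgebra = 2)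
    (φ : A ⟶ A) {d : ℕ} (hd : 0 < d) (hφ : φ ≫ φ = -(d • 𝟙 A))
    (hE1 : ∀ j, (E j).dim = 1) (χ : ∀ j, E j ⟶ E j) (dE : Fin (m + 1) → ℕ) (hdE : ∀ j, 0 < dE j) (hχ : ∀ j, χ j ≫ χ j = -(dE j • 𝟙 (E j)))
    (hfree : ∀ i j, i ≠ j → ∀ s : ℚ, (dE i : ℚ) ≠ s ^ 2 * dE j)
    (hbal : eigenMultiplicity A φ (Complex.I * (Real.sqrt d : ℂ)) = eigenMultiplicity A φ (-(Complex.I * (Real.sqrt d : ℂ))) ∨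
      ∀ j, ∀ s : ℚ, (d : ℚ) ≠ s ^ 2 * dE j) :
    haveI := BettiUniverse.finite hP 1
    haveI := BettiUniverse.finite hA 1
    Module.finrank ℚ (BettiUniverse.hodge exists_isReal_hodgeModel_holds hP 1).hodgeLie =
      Module.finrank ℚ (BettiUniverse.hodge exists_isReal_hodgeModel_holds hA 1).hodgeLie + (m + 1) := by
  classical
  have hnA : A.dim = n₁ := schemeDim_eq_holds hA
  subst hnA
  haveI := BettiUniverse.finite hP 1
  haveI := BettiUniverse.finite hA 1
  haveI := BettiUniverse.finite hY 1
  -- the bicone of `H¹`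
  let ι₁ := BettiUniverse.pullHodgeHom exists_isReal_hodgeModel_holds hodgePQ_independent_of_hodgeModel_holds hP hA
    (fst A (⨁ E)).hom.hom.hom 1
  let π₁ := BettiUniverse.pullHodgeHom exists_isReal_hodgeModel_holds hodgePQ_independent_of_hodgeModel_holds hA hP
    (prodLift (𝟙 A) (0 : A ⟶ ⨁ E)).hom.hom.hom 1
  let ι₂ := BettiUniverse.pullHodgeHom exists_isReal_hodgeModel_holds hodgePQ_independent_of_hodgeModel_holds hP hY
    (snd A (⨁ E)).hom.hom.hom 1
  let π₂ := BettiUniverse.pullHodgeHom exists_isReal_hodgeModel_holds hodgePQ_independent_of_hodgeModel_holds hY hP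
    (prodLift (0 : ⨁ E ⟶ A) (𝟙 (⨁ E))).hom.hom.hom 1
  have hsumP : fst A (⨁ E) ≫ prodLift (𝟙 A) (0 : A ⟶ ⨁ E) + snd A (⨁ E) ≫ prodLift (0 : ⨁ E ⟶ A) (𝟙 (⨁ E)) = 𝟙 _ := by
    refine prod_hom_ext ?_ ?_
    · rw [Preadditive.add_comp, Category.assoc, Category.assoc, prodLift_fst, prodLift_fst, Category.comp_id,
        comp_zero, add_zero, Category.id_comp]
    · rw [Preadditive.add_comp, Category.assoc, Category.assoc, prodLift_snd, prodLift_snd, Category.comp_id,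
        comp_zero, zero_add, Category.id_comp]
  have hπι₁ : ∀ v, π₁.toLinearMap (ι₁.toLinearMap v) = v := fun v => pull_pull_eq_self_of_comp_eq_id (prodLift_fst _ _) v
  have hπι₂ : ∀ v, π₂.toLinearMap (ι₂.toLinearMap v) = v := fun v => pull_pull_eq_self_of_comp_eq_id (prodLift_snd _ _) v
  have hsum : ∀ v, ι₁.toLinearMap (π₁.toLinearMap v) + ι₂.toLinearMap (π₂.toLinearMap v) = v := fun v =>
    pull_pull_add_pull_pull_eq_self _ _ _ _ hsumP v
  -- polarizations, Hodge operators
  obtain ⟨ψ⟩ := BettiUniverse.hodge_isPolarizable exists_isReal_hodgeModel_holds hP 1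
  obtain ⟨ψ₁⟩ := BettiUniverse.hodge_isPolarizable exists_isReal_hodgeModel_holds hA 1
  obtain ⟨Θ₁, hΘ₁⟩ := exists_hodgeTheta (BettiUniverse.hodge exists_isReal_hodgeModel_holds hA 1)
  obtain ⟨Θ₂, hΘ₂⟩ := exists_hodgeTheta (BettiUniverse.hodge exists_isReal_hodgeModel_holds hY 1)
  -- the data on `A`: `φ^*` and the skew centre `ℚφ^*`
  obtain ⟨hφE, hφ2, hZ⟩ := quadraticEnd_skewCentre_data exists_isReal_hodgeModel_holds hodgePQ_independent_of_hodgeModel_holds hA0 hA2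
    hd hφ ψ₁
  -- the data on `Y = ⨁E`
  obtain ⟨hab₂, h𝔥Y⟩ := hodgeLie_hodge_one_biproduct_cmCurves_comm_and_finrank hY hE1 χ dE hdE hχ hfree
  -- the slope
  set T : ℚ := LinearMap.trace ℚ _ ((bettiCohomology.map φ.hom.hom.hom 1).hom * (bettiCohomology.map φ.hom.hom.hom 1).hom) with hTdef
  set Sc : ℂ := LinearMap.trace ℂ _ (Θ₁ * (bettiCohomology.map φ.hom.hom.hom 1).hom.baseChange ℂ) with hScdef
  have hT : T = -((d : ℚ) * (2 * A.dim)) := trace_pullback_mul_self_eq φ hφ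
  have hT0 : T ≠ 0 := by
    rw [hT]
    have hdQ : (d : ℚ) ≠ 0 := by exact_mod_cast hd.ne'
    have hdim : ((A.dim : ℕ) : ℚ) ≠ 0 := by exact_mod_cast hA0.ne'
    exact neg_ne_zero.2 (mul_ne_zero hdQ (mul_ne_zero two_ne_zero hdim))
  set r : ℚ := (eigenMultiplicity A φ (Complex.I * (Real.sqrt d : ℂ)) : ℚ) - (eigenMultiplicity A φ (-(Complex.I * (Real.sqrt d : ℂ))) : ℚ)
    with hrdef
  have hSc : Sc = 2 * (Complex.I * (Real.sqrt d : ℂ)) * (r : ℂ) := by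
    rw [hScdef, trace_theta_mul_baseChange_pullback_eq exists_isReal_hodgeModel_holds hodgePQ_independent_of_hodgeModel_holds φ hd hφ hΘ₁, hrdef]
    push_cast
    ring
  have hr : r = 0 ∨ ∀ j, ∀ s : ℚ, (d : ℚ) ≠ s ^ 2 * dE j := by
    rcases hbal with h | h
    · left
      rw [hrdef, h, sub_self]
    · exact Or.inr h
  -- twisted rigidity of `H¹Y` for this slope
  have hrig : ∀ K : Submodule ℚ (Module.End ℚ (bettiCohomology (⨁ E).X 1)), K ≤ (BettiUniverse.hodge exists_isReal_hodgeModel_holds hY 1).hodgeLie →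
      ∀ y₀ ∈ (BettiUniverse.hodge exists_isReal_hodgeModel_holds hY 1).hodgeLie,
        ((T : ℚ) : ℂ) • Θ₂ - Sc • y₀.baseChange ℂ ∈ spanC K → (BettiUniverse.hodge exists_isReal_hodgeModel_holds hY 1).hodgeLie ≤ K := by
    intro K hK y₀ hy₀ hmem
    rw [hSc] at hmem
    exact hodgeLie_hodge_one_biproduct_cmCurves_le_of_resonance hY hE1 χ dE hdE hχ hfree hΘ₂ hT0 hd hr K hK hy₀ hmem
  have h := (corners_mem_and_exists_linearEquiv_prod_of_abelian_of_rigid ι₁ π₁ ι₂ π₂ hπι₁ hπι₂ hsum ψ ψ₁ hφE hZ hab₂ hΘ₁ hΘ₂ hrig).2.2.2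
  rw [h, h𝔥Y]

/-! ## §2 The field form: `t(X) = t(A) + m + 1` -/

/-- **The tower theorem: `t(X) = t(A) + m + 1` for `X ∼ A × ⨁_{j ≤ m} E_j`**, `A` with `0 < dim A`, `dim_ℚ End⁰A = 2`, `φ ∘ φ = −d`, the `E_j` pairwise
non-isogenous CM elliptic curves, and EITHER `A` balanced (`n₊ = n₋`) OR no ring homomorphism `End⁰E_j → End⁰A` for every `j` — i.e.
`Hg(A × E₀ × ⋯ × E_m) = Hg(A) × U_{k₀} × ⋯ × U_{k_m}`: Moonen–Zarhin's «`Hg(X₁ × X₂) = Hg(X₁) × Hg(X₂)` unless the centre of `Hg(X₁)` contains a torus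
isogenous to a quotient of `Hg(X₂)`» for `m + 1` CM curves at once. [cite: MoonenZarhin1999LowDim, §3 Lemma (3.6) and Prop. (3.8)] -/
theorem mtRank_hodge_one_eq_add_of_isIsogenous_prod_biproduct_cmCurves (hX : IsSmoothProjective n X.X) (hA : IsSmoothProjective n₁ A.X)
    (hA0 : 0 < A.dim) (hA2 : Module.finrank ℚ A.endAlgebra = 2) (φ : A ⟶ A) {d : ℕ} (hd : 0 < d) (hφ : φ ≫ φ = -(d • 𝟙 A))
    (hE1 : ∀ j, (E j).dim = 1) (hEcm : ∀ j, IsOfCMType (E j)) (hniso : ∀ i j, i ≠ j → ¬ IsIsogenous (E i) (E j))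
    (hbal : eigenMultiplicity A φ (Complex.I * (Real.sqrt d : ℂ)) = eigenMultiplicity A φ (-(Complex.I * (Real.sqrt d : ℂ))) ∨
      ∀ j, IsEmpty ((E j).endAlgebra →+* A.endAlgebra))
    (hXP : IsIsogenous X (A.prod (⨁ E))) :
    haveI := BettiUniverse.finite hX 1
    haveI := BettiUniverse.finite hA 1
    (BettiUniverse.hodge exists_isReal_hodgeModel_holds hX 1).mtRank = (BettiUniverse.hodge exists_isReal_hodgeModel_holds hA 1).mtRank + (m + 1) := by
  classical
  have hY : IsSmoothProjective (⨁ E).dim (⨁ E).X := AbelianVariety.isSmoothProjective_holds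
  have hP : IsSmoothProjective (A.prod (⨁ E)).dim (A.prod (⨁ E)).X := AbelianVariety.isSmoothProjective_holds
  haveI := BettiUniverse.finite hX 1
  haveI := BettiUniverse.finite hA 1
  haveI := BettiUniverse.finite hY 1
  haveI := BettiUniverse.finite hP 1
  -- complex multiplications on the curves
  have hcm := fun j => exists_hom_comp_self_eq_neg_of_cmCurve (hE1 j) (hEcm j)
  choose χ dE hdE hχ using hcm
  have hE2 : ∀ j, Module.finrank ℚ (E j).endAlgebra = 2 := fun j => finrank_endAlgebra_eq_two_of_cmCurve (hE1 j) (hEcm j)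
  -- distinct fields: `d_i ≠ s² d_j`
  have hfree : ∀ i j, i ≠ j → ∀ s : ℚ, (dE i : ℚ) ≠ s ^ 2 * dE j := by
    intro i j hij
    have hfor : IsEmpty ((E j).endAlgebra →+* (E i).endAlgebra) := by
      by_contra hne
      rw [not_isEmpty_iff] at hne
      exact hniso i j hij (isIsogenous_of_nonempty_ringHom_of_cmCurves (hE1 i) (hEcm i) (hE1 j) (hEcm j) hne)
    exact forall_ne_sq_mul_of_isEmpty_ringHom hfor (hE2 j) (hdE j) (hχ j) (hχ i) (hdE i)
  have hbal' : eigenMultiplicity A φ (Complex.I * (Real.sqrt d : ℂ)) = eigenMultiplicity A φ (-(Complex.I * (Real.sqrt d : ℂ))) ∨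
      ∀ j, ∀ s : ℚ, (d : ℚ) ≠ s ^ 2 * dE j := by
    rcases hbal with h | h
    · exact Or.inl h
    · exact Or.inr fun j => forall_ne_sq_mul_of_isEmpty_ringHom (h j) (hE2 j) (hdE j) (hχ j) hφ hd
  have h0 : 0 < X.dim := by
    obtain ⟨f, hf⟩ := hXP
    rw [dim_eq_of_isIsogeny hf, dim_prod]; omega
  have h := finrank_hodgeLie_hodge_one_prod_biproduct_cmCurves_eq_add hA hY hP hA0 hA2 φ hd hφ hE1 χ dE hdE hχ hfree hbal'
  rw [← finrank_hodgeLie_hodge_one_eq_of_isIsogenous hX hP hXP] at h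
  rw [mtRank_hodge_one_eq_finrank_hodgeLie_add_one hX h0, mtRank_hodge_one_eq_finrank_hodgeLie_add_one hA hA0]
  omega

/-- **The bound `t(X) ≤ t(A) + m + 1` for `X ∼ A × ⨁E` with ANY CM elliptic curves `E₀, …, E_m`** (subadditivity `t(X₁ × X₂) + 1 ≤ t(X₁) + t(X₂)` and
`t(⨁E) ≤ m + 2`, Kubota): the tower theorem says the bound is attained exactly in the distinct-field configuration. [cite: MoonenZarhin1999LowDim, §3 (3.1) and Prop. (3.8)] -/
theorem mtRank_hodge_one_le_add_of_isIsogenous_prod_biproduct_cmCurves (hX : IsSmoothProjective n X.X) (hA : IsSmoothProjective n₁ A.X)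
    (hA0 : 0 < A.dim) (hE1 : ∀ j, (E j).dim = 1) (hEcm : ∀ j, IsOfCMType (E j)) (hXP : IsIsogenous X (A.prod (⨁ E))) :
    haveI := BettiUniverse.finite hX 1
    haveI := BettiUniverse.finite hA 1
    (BettiUniverse.hodge exists_isReal_hodgeModel_holds hX 1).mtRank ≤
      (BettiUniverse.hodge exists_isReal_hodgeModel_holds hA 1).mtRank + (m + 1) := by
  classical
  have hY : IsSmoothProjective (⨁ E).dim (⨁ E).X := AbelianVariety.isSmoothProjective_holds
  haveI := BettiUniverse.finite hX 1
  haveI := BettiUniverse.finite hA 1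
  haveI := BettiUniverse.finite hY 1
  have hY0 : 0 < (⨁ E).dim := by
    rw [AndreRiemann.dim_biproduct_fin E, Finset.sum_congr rfl fun j _ => hE1 j]
    simp
  have hle := mtRank_hodge_one_add_one_le_add_of_isIsogenous_prod hA hY hA0 hY0 hX hXP
  obtain ⟨a, b, -, hab, ht, ha0, -⟩ := exists_mtRank_hodge_one_eq_of_biproduct_curves hY (E := E) hE1 (IsIsogenous.refl _)
  have ha : a = 0 := ha0.2 hEcm
  omega

/-! ## §3 Cells: a simple type-IV(2,1) threefold, or a Ribet-type factor, times many CM curves -/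

/-- **Simple type-IV(2,1) threefold × (m+1) pairwise non-isogenous CM elliptic curves, none of whose fields maps to `End⁰T`: `t = m + 11`**
(`t(T) = 10`; `Hg = U(2,1) × U_{k₀} × ⋯ × U_{k_m}`).  `m = 0`: gen 48's `11`; `m = 1`: gen 50's `12`. [cite: MoonenZarhin1999LowDim, Thm. 0.1 (4), §3 Lemma (3.6) and Prop. (3.8)] -/
theorem mtRank_hodge_one_eq_of_isIsogenous_typeIV_threefold_prod_biproduct_cmCurves (hX : IsSmoothProjective n X.X) {T : AbelianVariety ℂ}
    (hTs : T.IsSimple) (hT3 : T.dim = 3) (hTE : Module.finrank ℚ T.endAlgebra = 2)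
    (hE1 : ∀ j, (E j).dim = 1) (hEcm : ∀ j, IsOfCMType (E j)) (hniso : ∀ i j, i ≠ j → ¬ IsIsogenous (E i) (E j))
    (hfor : ∀ j, IsEmpty ((E j).endAlgebra →+* T.endAlgebra)) (hXP : IsIsogenous X (T.prod (⨁ E))) :
    haveI := BettiUniverse.finite hX 1
    (BettiUniverse.hodge exists_isReal_hodgeModel_holds hX 1).mtRank = m + 11 := by
  have hT : IsSmoothProjective T.dim T.X := AbelianVariety.isSmoothProjective_holds
  haveI := BettiUniverse.finite hX 1
  haveI := BettiUniverse.finite hT 1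
  obtain ⟨φ, d, hd, hφ⟩ := exists_hom_comp_self_eq_neg_of_isSimple_threefold_of_finrank_eq_two hTs hT3 hTE
  have h10 : (BettiUniverse.hodge exists_isReal_hodgeModel_holds hT 1).mtRank = 10 :=
    (mtRank_hodge_one_of_isSimple_threefold_of_finrank_endAlgebra_eq_two hT hTs hT3 hTE).1
  have h := mtRank_hodge_one_eq_add_of_isIsogenous_prod_biproduct_cmCurves hX hT (by omega) hTE φ hd hφ hE1 hEcm hniso (Or.inr hfor) hXP
  omega

/-- **Ribet type `(g−1,1)` × (m+1) pairwise non-isogenous CM elliptic curves, none of whose fields maps to `End⁰A`: `t = g² + m + 2`** (`A` of dimension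
`g ≥ 3` with `End⁰A` a non-real quadratic field, `φ ∘ φ = −d` with multiplicity one at `±i√d`, `t(A) = g² + 1`). [cite: MoonenZarhin1999LowDim, §3 Lemma (3.6) and Prop. (3.8)]
[cite: Ribet1983, Thm. 3] -/
theorem mtRank_hodge_one_eq_of_isIsogenous_ribetTypeOne_prod_biproduct_cmCurves (hX : IsSmoothProjective n X.X) (hF : IsField A.endAlgebra)
    (hnR : ¬ NumberField.IsTotallyReal (EndField A hF)) (φ : A ⟶ A) {d : ℕ} (hd : 0 < d) (hφ : φ ≫ φ = -(d • 𝟙 A))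
    (hA2 : Module.finrank ℚ A.endAlgebra = 2)
    (h1 : eigenMultiplicity A φ (Complex.I * (Real.sqrt d : ℂ)) = 1 ∨ eigenMultiplicity A φ (-(Complex.I * (Real.sqrt d : ℂ))) = 1) (hdim : 3 ≤ A.dim)
    (hE1 : ∀ j, (E j).dim = 1) (hEcm : ∀ j, IsOfCMType (E j)) (hniso : ∀ i j, i ≠ j → ¬ IsIsogenous (E i) (E j))
    (hfor : ∀ j, IsEmpty ((E j).endAlgebra →+* A.endAlgebra)) (hXP : IsIsogenous X (A.prod (⨁ E))) :
    haveI := BettiUniverse.finite hX 1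
    (BettiUniverse.hodge exists_isReal_hodgeModel_holds hX 1).mtRank = A.dim * A.dim + m + 2 := by
  have hA : IsSmoothProjective A.dim A.X := AbelianVariety.isSmoothProjective_holds
  haveI := BettiUniverse.finite hX 1
  haveI := BettiUniverse.finite hA 1
  have hgg := (mtRank_hodge_one_of_ribetTypeOne' hA hF hnR φ hd hφ hA2 h1 hdim).1
  have h := mtRank_hodge_one_eq_add_of_isIsogenous_prod_biproduct_cmCurves hX hA (by omega) hA2 φ hd hφ hE1 hEcm hniso (Or.inr hfor) hXP
  omega

/-- **Balanced `A` (`n₊ = n₋`, Weil-type action of `ℚ(√−d)`): `t(A × ⨁E) = t(A) + m + 1` for ANY pairwise non-isogenous CM elliptic curves**, whatever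
their fields (the slope `tr(Θ_A φ^*)` vanishes, so no resonance is possible). [cite: MoonenZarhin1999LowDim, §3 Lemma (3.6)] -/
theorem mtRank_hodge_one_eq_add_of_isIsogenous_balanced_prod_biproduct_cmCurves (hX : IsSmoothProjective n X.X) (hA : IsSmoothProjective n₁ A.X)
    (hA0 : 0 < A.dim) (hA2 : Module.finrank ℚ A.endAlgebra = 2) (φ : A ⟶ A) {d : ℕ} (hd : 0 < d) (hφ : φ ≫ φ = -(d • 𝟙 A))
    (hbal : eigenMultiplicity A φ (Complex.I * (Real.sqrt d : ℂ)) = eigenMultiplicity A φ (-(Complex.I * (Real.sqrt d : ℂ))))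
    (hE1 : ∀ j, (E j).dim = 1) (hEcm : ∀ j, IsOfCMType (E j)) (hniso : ∀ i j, i ≠ j → ¬ IsIsogenous (E i) (E j))
    (hXP : IsIsogenous X (A.prod (⨁ E))) :
    haveI := BettiUniverse.finite hX 1
    haveI := BettiUniverse.finite hA 1
    (BettiUniverse.hodge exists_isReal_hodgeModel_holds hX 1).mtRank = (BettiUniverse.hodge exists_isReal_hodgeModel_holds hA 1).mtRank + (m + 1) :=
  mtRank_hodge_one_eq_add_of_isIsogenous_prod_biproduct_cmCurves hX hA hA0 hA2 φ hd hφ hE1 hEcm hniso (Or.inl hbal) hXP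

end Summit.HodgeConjecture.CorCM

end
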